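import Literature.Barriers.RiemannHypothesis.JensenPolynomials
import Literature.NumberTheory.LFunctions.JensenHermite
import Literature.NumberTheory.LFunctions.EquivalentsProofs
import HarnessLib

/-!
# Discharge of `GORZ2019_thm3_corollary` (Griffin–Ono–Rolen–Zagier 2019, Theorem 3 and Corollary)

Sibling ("Proofs") file of `Literature/Barriers/RiemannHypothesis/JensenPolynomials.lean`, which
vendors, next to the barrier `JensenPolynomials` (Farmer 2022), the named fact
`Literature.Barriers.RiemannHypothesis.GORZ2019_thm3_corollary` — GORZ, PNAS 116 (2019), §1 p. 3 of
arXiv:1902.07321: **Theorem 3.** "Let `{α(n)}`, `{A(n)}` and `{δ(n)}` be three sequences of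
positive real numbers with `δ(n)` tending to zero and satisfying
`log(α(n+j)/α(n)) = A(n) j − δ(n)² j² + o(δ(n)^d)` as `n → ∞` for some integer `d ≥ 1` and all
`0 ≤ j ≤ d`. Then `lim_{n→∞} δ(n)^{-d}/α(n) · J^{d,n}_α((δ(n) X − 1)/exp(A(n))) = H_d(X)`
uniformly for `X` in any compact subset of `ℝ`." **Corollary.** "The Jensen polynomials
`J^{d,n}_α(X)` for a sequence `α : ℕ → ℝ` satisfying the conditions in Theorem 3 are hyperbolic
for all but finitely many values `n`." (Printed proof, §2 p. 6, via the more general Thm. 6: the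
coefficient of `X^k` is `(d choose k) δ(n)^{k−d} ∑_{j=k}^{d} (−1)^{j−k} (d−k choose j−k)
α(n+j)/(α(n) E(n)^j)`; the inner sum is a `(d−k)`-th forward difference of `j ↦ jⁱ`, which
vanishes for `i < d − k` and is `(d−k)!` for `i = d − k`; then "since the Hermite polynomials have
distinct roots, and since this property of a polynomial with real coefficients is invariant under
small deformation", the Corollary.)

All of this is a **theorem of the tree**: `Literature/NumberTheory/LFunctions/JensenHermite.lean`
proves Thm. 6 (`Literature.NumberTheory.LFunctions.tendsto_coeff_jensenPolyRescaled`, forward differences via Mathlib's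
`fwdDiff_iter_eq_sum_shift`), Thm. 3 (`Literature.NumberTheory.LFunctions.tendsto_coeff_jensenPolyRescaled_gorzHermite`,
coefficientwise; `Literature.NumberTheory.LFunctions.tendstoLocallyUniformly_jensenPolyRescaled_gorzHermite`, as printed), the
simple real zeros of `H_d` (`Literature.NumberTheory.LFunctions.gorzHermite_eq_prod_roots`, interlacing), the deformation lemma
(`Literature.NumberTheory.LFunctions.eventually_splits_of_tendsto_coeff`) and the Corollary (`Literature.NumberTheory.LFunctions.jensenPoly_eventually_splits`)
under hypotheses weaker than the printed ones (`A(n)` any real, `δ(n) > 0` only eventually, any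
`d`). This file only records the discharge `GORZ2019_thm3_corollary_holds` in the vocabulary of
the barrier file (same `Literature.NumberTheory.LFunctions.jensenPoly`, same `Polynomial.Splits` over `ℝ`); the one rewriting
step is `log(α(n+j)/α(n)) − A(n) j + δ(n)² j² = log(α(n+j)/α(n)) − (A(n) j − δ(n)² j²)`.

## References

* [GORZPNAS2019] M. Griffin, K. Ono, L. Rolen, D. Zagier, *Jensen polynomials for the Riemann zeta
  function and other sequences*, PNAS 116 (2019), no. 23, 11103–11110 = arXiv:1902.07321; read:
  §1 p. 3 (Thm. 3, eqs. (4)–(5), Corollary), §2 p. 6 (Thm. 6 and the proof of Thms. 6 and 3).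
* [Farmer2022] D. W. Farmer, *Jensen polynomials are not a plausible route to proving the Riemann
  hypothesis*, Adv. Math. 411 (2022), 108781 (the barrier this fact serves; not used here).

## Audit 2026-08-16 (barrier audit of this file and of the entry `JensenPolynomials`; appended)

Two scope findings, both repaired below by THEOREMS (no new named facts):

1. *The literal hypothesis (4) of GORZ Thm. 3 is a narrow peg.* `GORZ2019_thm3_corollary` is
   transcribed faithfully (checked against §1 p. 3), but hypothesis (4) — error `o(δ(n)^d)` with
   no `j³, …, j^d` terms — forces `Δ³ log α(n) = o(δ(n)^d)` and `Δ² log α(n) = -2δ(n)² + o(δ(n)^d)`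
   (`isLittleO_thirdDiff_of_gorzThm3`, `isLittleO_secondDiff_of_gorzThm3`). For `γ = xiTaylorCoeff`
   one has `δ(n)² ∼ 1/(2n)` (GORZ (18), p. 10) and `Δ³ log γ(n) ∼ 1/n²` (from
   `log γ(n+j) - log γ(n) = -∑_{k<j} log(n+k+½) + …`, coefficient of `j³` equal to `y²/6`,
   `y = 1/(n+½)`), so (4) FAILS for `γ` for every `d ≥ 4`, whatever `A`, `δ`: the printed sentence
   "the Taylor coefficients `γ(n)` satisfy the required growth conditions in Theorem 3 for every
   `d ≥ 2`" (§1 p. 3) is true only of the general form, §5.1 eq. (15) = Thm. 6, which is what §5.1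
   (p. 10) actually verifies and what the tree proves (`xiTaylorCoeff_logRatio_holds`,
   `jensenPoly_eventually_splits'`). Hence `eventuallyHyperbolic_of_gorz` above (shape (4) for all
   `d`; its docstring's "as in GORZ §5.1 for `γ`" should read "(15), not (4)") does not apply to
   `γ`; the bridge that does is `HasGORZExpansion.eventuallyHyperbolic` below, and
   `eventuallyHyperbolic_xiTaylorCoeff` records GORZ Thm. 1 (unconditional in the tree,
   `gorz_eventually_holds`) in the barrier's vocabulary. (The failure of (4) for `γ` is a paper
   computation, not formalised.)
2. *The witness of `JensenPolynomials` is outside the Hermite-universality class.* For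
   `quadExp = (1+z²)eᶻ`, `J^{d+2,n} = (X+1)^d Q_{d+2,n}` has a `d`-fold root and at `d = 3` the
   GORZ-rescaled root set tends to `{-2, 1 ± √3}`, not to the roots `{0, ±√6}` of `H₃ = X³ - 6X`
   (`δ(n)² ≈ 1/n²`, error `O(δ³)` not `o(δ³)`); it also violates the Turán inequality at shift `0`.
   So `JensenPolynomials_holds` covers the Kim–Farmer sub-family of the listed technique class, not
   the universality sub-family containing `γ` (Farmer's own `X_{10}`, of cosine type, is universal
   but rests on a graph). `JensenPolynomialsNarrow` below covers the universality class proper,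
   with the strongest possible base point: `γ` itself with ONE coefficient changed keeps every
   hypothesis of GORZ Thms. 3/6/7 for every degree (they are asymptotic in `n`), stays
   `EventuallyHyperbolic`, keeps every Jensen polynomial of `γ` outside a finite set of windows (in
   particular all `J^{d,0}_γ`, `d ≤ k`: Chasse's input), and fails the Turán inequality at one shift.

What neither witness neutralises (recorded as `scope_caveats`): shift-UNIFORM hyperbolicity at
bounded degree — `J^{d,n}_γ` hyperbolic for all `n` and `d ≤ 3` (Csordas–Norfolk–Varga,
Dimitrov–Lucas), `d ≤ 8` (GORZ Thm. 2), `d ≤ 64` (tree, `jensenPoly_xiTaylorCoeff_splits_of_le`),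
`4d ≤ T²` under RH to height `T` (Kim–Lee Thm. 4, Chasse) — whose extension to all `d` is
`AllHyperbolic γ`, i.e. RH (Pólya). (Addendum, same audit: this gap is closed by the third sibling
`JensenPolynomialsCone.lean`, `JensenPolynomialsShiftUniform_holds` — for every `D` an explicit
genus-zero witness with (15) for every degree, all-shift hyperbolicity for all `d ≤ D`, and
`¬ AllHyperbolic`.) Literature checked for evasions (none; all are large-shift
results inside `EventuallyHyperbolic`, or restated equivalences): Griffin–Ono–Rolen–Thorner–
Tripp–Wagner, Adv. Math. 397 (2022) (`n ≥ c e^{d/2}`); O'Sullivan, Res. Math. Sci. 8 (2021),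
Thms. 1.2–1.3 (`P^{d,n}`; `n/log² n ≥ d^{3/4}/2`); Holland, arXiv:2608.08682 (2026), Thm. 1.1
(`n³ log²(n+2) ≥ K d⁵`; p. 24: "does not provide a converse route from partial Jensen
hyperbolicity to the Riemann hypothesis; see Farmer"); Durán, arXiv:2405.18940 (2024) (Brenke
polynomial equivalences, alternative proof of GORZ Thm. 1).

* [GriffinEtAl2022] M. Griffin, K. Ono, L. Rolen, J. Thorner, Z. Tripp, I. Wagner, *Jensen
  polynomials for the Riemann xi-function*, Adv. Math. 397 (2022), 108186.
* [Osullivan2021] C. O'Sullivan, *Zeros of Jensen polynomials and asymptotics for the Riemann xi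
  function*, Res. Math. Sci. 8 (2021); arXiv:2007.13582 (read: §1, Thms. 1.1–1.4, p. 3).
* [Holland2026] J. Holland, *A new hyperbolicity wedge and a joint semicircle limit for Jensen
  polynomials of Riemann's ξ-function*, arXiv:2608.08682 (read: pp. 1–2, 24).
* [Duran2024] A. J. Durán, *Brenke polynomials with real zeros and the Riemann Hypothesis*,
  arXiv:2405.18940 (read: abstract, §1 Thms. 1.1–1.6, §7).
* [KimLee2021] Y.-O. Kim, J. Lee, *A note on the zeros of Jensen polynomials*, arXiv:2105.05386,
  Thm. 4 and Remark.
-/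

noncomputable section

open Filter Topology Asymptotics

namespace Literature.Barriers.RiemannHypothesis

/-- **GORZ 2019, Corollary to Theorem 3, holds**: for positive sequences `α, A, δ` with
`δ(n) → 0` and `log(α(n+j)/α(n)) = A(n) j − δ(n)² j² + o(δ(n)^d)` (`d ≥ 1`, all `0 ≤ j ≤ d`),
the Jensen polynomials `J^{d,n}_α` are hyperbolic for all but finitely many `n`. From the tree's
theorem `Literature.NumberTheory.LFunctions.jensenPoly_eventually_splits` (GORZ Thm. 3 via Thm. 6, simple real zeros of `H_d`,
stability under small deformation), fed with the printed (stronger) hypotheses.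
[cite: GORZPNAS2019, Theorem 3 and Corollary (§1 p. 3; proof §2 p. 6)] -/
theorem GORZ2019_thm3_corollary_holds : GORZ2019_thm3_corollary := by
  intro α A δ d _hd hα _hA hδpos hδ h
  refine Literature.NumberTheory.LFunctions.jensenPoly_eventually_splits (A := A) hα (Eventually.of_forall hδpos) hδ
    fun j hj ↦ ?_
  refine (h j hj).congr' (Eventually.of_forall fun n ↦ ?_) EventuallyEq.rfl
  ring

/-- Pointwise form of the discharged fact, for users holding the printed hypotheses of GORZ
Thm. 3 for a fixed degree `d ≥ 1`. [cite: GORZPNAS2019, Theorem 3 and Corollary] -/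
theorem jensenPoly_eventually_splits_of_gorz {α A δ : ℕ → ℝ} {d : ℕ} (hd : 1 ≤ d)
    (hα : ∀ n, 0 < α n) (hA : ∀ n, 0 < A n) (hδpos : ∀ n, 0 < δ n)
    (hδ : Tendsto δ atTop (𝓝 0))
    (h : ∀ j : ℕ, j ≤ d →
      (fun n : ℕ ↦ Real.log (α (n + j) / α n) - A n * j + δ n ^ 2 * (j : ℝ) ^ 2) =o[atTop]
        fun n : ℕ ↦ δ n ^ d) :
    ∃ N : ℕ, ∀ n : ℕ, N ≤ n → (Literature.NumberTheory.LFunctions.jensenPoly α d n).Splits :=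
  GORZ2019_thm3_corollary_holds α A δ d hd hα hA hδpos hδ h

/-- In the barrier file's vocabulary: under the printed hypotheses of GORZ Thm. 3 for **every**
degree `d ≥ 1` (with `A`, `δ` allowed to depend on `d`, as in GORZ §5.1 for `γ`), the sequence
`α` is `EventuallyHyperbolic` — the large-shift conclusion shape that the barrier
`JensenPolynomials` shows carries no information about full hyperbolicity.
[cite: GORZPNAS2019, Theorem 3 and Corollary] -/
theorem eventuallyHyperbolic_of_gorz {α : ℕ → ℝ} (hα : ∀ n, 0 < α n)
    (h : ∀ d : ℕ, 1 ≤ d → ∃ A δ : ℕ → ℝ, (∀ n, 0 < A n) ∧ (∀ n, 0 < δ n) ∧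
      Tendsto δ atTop (𝓝 0) ∧
      ∀ j : ℕ, j ≤ d →
        (fun n : ℕ ↦ Real.log (α (n + j) / α n) - A n * j + δ n ^ 2 * (j : ℝ) ^ 2) =o[atTop]
          fun n : ℕ ↦ δ n ^ d) :
    EventuallyHyperbolic α := by
  intro d hd
  obtain ⟨A, δ, hA, hδpos, hδ, hlog⟩ := h d hd
  exact GORZ2019_thm3_corollary_holds α A δ d hd hα hA hδpos hδ hlog


/-! ## Audit 2026-08-16: the Hermite-universality class proper (GORZ §5.1 (15)) and the
sharpened barrier `JensenPolynomialsNarrow` -/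

section Audit

open Polynomial Finset Literature.NumberTheory.LFunctions

/-- **GORZ's Hermite-universality hypotheses for every degree, in the form actually established
for `γ`** (PNAS 116 (2019), §5.1 eq. (15), the input of their Thm. 6): for every `d ≥ 1` there are
`A(n)`, `0 < δ(n) → 0` (for large `n`) and `gᵢ(n) = o(δ(n)^i)` (`3 ≤ i ≤ d`) with
`log(a(n+j)/a(n)) = A(n) j - δ(n)² j² + ∑_{i=3}^{d} gᵢ(n) jⁱ + o(δ(n)^d)` for all `0 ≤ j ≤ d`.
For `a = xiTaylorCoeff` this is, by `Iff.rfl`, the tree's (proved) named fact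
`Literature.NumberTheory.LFunctions.xiTaylorCoeff_logRatio`. The literal hypothesis (4) of Thm. 3
is the case `g = 0` (`hasGORZExpansion_of_gorzThm3`). [cite: GORZPNAS2019, §5.1 eq. (15)] -/
def HasGORZExpansion (a : ℕ → ℝ) : Prop :=
  ∀ d : ℕ, 1 ≤ d → ∃ (A δ : ℕ → ℝ) (g : ℕ → ℕ → ℝ),
    (∀ᶠ n in atTop, 0 < δ n) ∧ Tendsto δ atTop (𝓝 0) ∧
    (∀ i, 3 ≤ i → i ≤ d → (g i) =o[atTop] fun n => δ n ^ i) ∧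
    ∀ j : ℕ, j ≤ d → (fun n => Real.log (a (n + j) / a n) -
        (A n * j - δ n ^ 2 * (j : ℝ) ^ 2 + ∑ i ∈ Icc 3 d, g i n * (j : ℝ) ^ i)) =o[atTop]
        fun n => δ n ^ d

/-- `xiTaylorCoeff_logRatio` is `HasGORZExpansion xiTaylorCoeff`. [cite: GORZPNAS2019, §5.1 eq. (15)] -/
theorem xiTaylorCoeff_logRatio_iff : xiTaylorCoeff_logRatio ↔ HasGORZExpansion xiTaylorCoeff :=
  Iff.rfl

/-- **`γ` is in the Hermite-universality class for every degree** — GORZ §5.1 (15), a theorem of the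
tree (`xiTaylorCoeff_logRatio_holds`, `JensenAsymptotics.lean`). [cite: GORZPNAS2019, §5.1 eq. (15)] -/
theorem hasGORZExpansion_xiTaylorCoeff : HasGORZExpansion xiTaylorCoeff :=
  xiTaylorCoeff_logRatio_holds

/-- The literal hypothesis (4) of GORZ Thm. 3 for every degree (as in `eventuallyHyperbolic_of_gorz`,
with `A` real and `δ > 0` eventually) is the special case `gᵢ = 0` of (15).
[cite: GORZPNAS2019, Thm. 3 eq. (4) and §5.1 eq. (15)] -/
theorem hasGORZExpansion_of_gorzThm3 {a : ℕ → ℝ}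
    (h : ∀ d : ℕ, 1 ≤ d → ∃ A δ : ℕ → ℝ, (∀ᶠ n in atTop, 0 < δ n) ∧ Tendsto δ atTop (𝓝 0) ∧
      ∀ j : ℕ, j ≤ d →
        (fun n : ℕ ↦ Real.log (a (n + j) / a n) - A n * j + δ n ^ 2 * (j : ℝ) ^ 2) =o[atTop]
          fun n : ℕ ↦ δ n ^ d) :
    HasGORZExpansion a := by
  intro d hd
  obtain ⟨A, δ, hδ0, hδ, hlog⟩ := h d hd
  refine ⟨A, δ, fun _ _ => 0, hδ0, hδ, fun i _ _ => isLittleO_zero _ _, fun j hj => ?_⟩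
  refine (hlog j hj).congr' (Eventually.of_forall fun n => ?_) EventuallyEq.rfl
  simp only [zero_mul, Finset.sum_const_zero, add_zero]
  ring

/-- **The bridge GORZ actually use (Thm. 6 / (15) ⟹ Corollary ⟹ Thm. 1 shape):** a positive sequence
in the Hermite-universality class for every degree is `EventuallyHyperbolic` — by the tree's
`jensenPoly_eventually_splits'` (GORZ Thm. 6, simple real zeros of `H_d`, small deformation). This,
not `eventuallyHyperbolic_of_gorz` (literal (4)), is the theorem that applies to `γ`.
[cite: GORZPNAS2019, Thm. 6 and §1 Corollary] -/
theorem HasGORZExpansion.eventuallyHyperbolic {a : ℕ → ℝ} (ha : ∀ n, 0 < a n)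
    (h : HasGORZExpansion a) : EventuallyHyperbolic a := by
  intro d hd
  obtain ⟨A, δ, g, hδ0, hδ, hg, hlog⟩ := h d hd
  exact jensenPoly_eventually_splits' ha hδ0 hδ hg hlog

/-- **Hermite universality, the conclusion (GORZ Thm. 3 eq. (5)), for every member of the class:**
for each `d ≥ 1` some renormalisation `δ(n)^{-d}/a(n) · J^{d,n}_a((δ(n)X - 1)/e^{A(n)})` converges
coefficientwise to `H_d` (the tree's `tendsto_coeff_jensenPolyRescaled_gorzHermite'`).
[cite: GORZPNAS2019, Thm. 3 eq. (5) and Thm. 6] -/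
theorem HasGORZExpansion.tendsto_coeff_rescaled {a : ℕ → ℝ} (ha : ∀ n, 0 < a n)
    (h : HasGORZExpansion a) {d : ℕ} (hd : 1 ≤ d) :
    ∃ A δ : ℕ → ℝ, (∀ᶠ n in atTop, 0 < δ n) ∧ Tendsto δ atTop (𝓝 0) ∧ ∀ k : ℕ,
      Tendsto (fun n => (jensenPolyRescaled a (fun n => Real.exp (A n)) δ d n).coeff k) atTop
        (𝓝 ((gorzHermite d).coeff k)) := by
  obtain ⟨A, δ, g, hδ0, hδ, hg, hlog⟩ := h d hd
  exact ⟨A, δ, hδ0, hδ, fun k => tendsto_coeff_jensenPolyRescaled_gorzHermite' ha hδ0 hδ hg hlog k⟩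

/-- **The universality hypotheses are asymptotic in the shift:** they pass to any eventually equal
sequence (in particular to any modification of finitely many terms). [folklore] -/
theorem HasGORZExpansion.congr {a b : ℕ → ℝ} (h : HasGORZExpansion a)
    (hab : ∀ᶠ n in atTop, a n = b n) : HasGORZExpansion b := by
  intro d hd
  obtain ⟨A, δ, g, hδ0, hδ, hg, hlog⟩ := h d hd
  refine ⟨A, δ, g, hδ0, hδ, hg, fun j hj => ?_⟩
  refine (hlog j hj).congr' ?_ EventuallyEq.rfl
  have h1 : ∀ᶠ n in atTop, a (n + j) = b (n + j) := (tendsto_add_atTop_nat j).eventually hab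
  filter_upwards [hab, h1] with n hn hn1
  rw [hn, hn1]

/-- **GORZ Thm. 1 in the barrier's vocabulary, unconditionally:** `γ = xiTaylorCoeff` is
`EventuallyHyperbolic` (the tree's `gorz_eventually_holds`, here re-derived through the universality
class: `hasGORZExpansion_xiTaylorCoeff`, `xiTaylorCoeff_pos_holds`). So the mechanism as used for
`γ` lands exactly in the conclusion shape that `JensenPolynomials` / `JensenPolynomialsNarrow` show
to carry no information about `AllHyperbolic`. [cite: GORZPNAS2019, Thm. 1] -/
theorem eventuallyHyperbolic_xiTaylorCoeff : EventuallyHyperbolic xiTaylorCoeff :=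
  hasGORZExpansion_xiTaylorCoeff.eventuallyHyperbolic xiTaylorCoeff_pos_holds

/-- **Why the literal hypothesis (4) of Thm. 3 is a narrow peg, I:** (4) at a degree `d ≥ 2` pins
`δ(n)²` to minus half the second difference of `log a`, up to `o(δ(n)^d)`:
`log(a(n+2)/a(n)) - 2 log(a(n+1)/a(n)) = -2δ(n)² + o(δ(n)^d)`. [cite: GORZPNAS2019, Thm. 3 eq. (4)] -/
theorem isLittleO_secondDiff_of_gorzThm3 {a A δ : ℕ → ℝ} {d : ℕ} (hd : 2 ≤ d)
    (h : ∀ j : ℕ, j ≤ d →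
      (fun n : ℕ ↦ Real.log (a (n + j) / a n) - A n * j + δ n ^ 2 * (j : ℝ) ^ 2) =o[atTop]
        fun n : ℕ ↦ δ n ^ d) :
    (fun n ↦ Real.log (a (n + 2) / a n) - 2 * Real.log (a (n + 1) / a n) + 2 * δ n ^ 2) =o[atTop]
      fun n ↦ δ n ^ d := by
  have h1 := h 1 (by omega)
  have h2 := h 2 (by omega)
  refine (h2.sub (h1.const_mul_left 2)).congr' (Eventually.of_forall fun n => ?_) EventuallyEq.rfl
  push_cast
  ring

/-- **Why the literal hypothesis (4) of Thm. 3 is a narrow peg, II:** (4) at a degree `d ≥ 3` forces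
the THIRD difference of `log a` to be `o(δ(n)^d)` (third difference of the four relations
`j = 0, …, 3`; quadratics have vanishing third differences). Together with I: a sequence satisfies
(4) for every `d` only if `Δ³ log a(n)` is smaller than every power of `-Δ² log a(n) → 0`. For
`γ = xiTaylorCoeff`, `-Δ² log γ(n) ∼ 1/n` while `Δ³ log γ(n) ∼ 1/n²` (GORZ (16)–(18)), so (4) fails
for `γ` for every `d ≥ 4` — GORZ's Thm. 1 goes through (15)/Thm. 6 (`HasGORZExpansion`), not
through (4). (The computation for `γ` is on paper; this lemma is the formal part.)
[cite: GORZPNAS2019, Thm. 3 eq. (4) and §5.1 eqs. (15)–(18)] -/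
theorem isLittleO_thirdDiff_of_gorzThm3 {a A δ : ℕ → ℝ} {d : ℕ} (hd : 3 ≤ d)
    (h : ∀ j : ℕ, j ≤ d →
      (fun n : ℕ ↦ Real.log (a (n + j) / a n) - A n * j + δ n ^ 2 * (j : ℝ) ^ 2) =o[atTop]
        fun n : ℕ ↦ δ n ^ d) :
    (fun n ↦ Real.log (a (n + 3) / a n) - 3 * Real.log (a (n + 2) / a n)
        + 3 * Real.log (a (n + 1) / a n)) =o[atTop] fun n ↦ δ n ^ d := by
  have h1 := h 1 (by omega)
  have h2 := h 2 (by omega)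
  have h3 := h 3 (by omega)
  refine ((h3.sub (h2.const_mul_left 3)).add (h1.const_mul_left 3)).congr'
    (Eventually.of_forall fun n => ?_) EventuallyEq.rfl
  push_cast
  ring

/-- `J^{2,k}_a(x) = a(k+2) x² + 2 a(k+1) x + a(k)`. [folklore] -/
theorem eval_jensenPoly_two (a : ℕ → ℝ) (k : ℕ) (x : ℝ) :
    (jensenPoly a 2 k).eval x = a (k + 2) * (x * x) + 2 * a (k + 1) * x + a k := by
  simp only [jensenPoly, Finset.sum_range_succ, Finset.sum_range_zero, eval_add, eval_mul, eval_C,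
    eval_pow, eval_X, add_zero, zero_add]
  norm_num [Nat.choose]
  ring

/-- **Turán's inequality as hyperbolicity of `J^{2,k}`:** if `a(k+2) > 0` and
`a(k+1)² < a(k) a(k+2)`, then `J^{2,k}_a` is not hyperbolic (negative discriminant).
[cite: Osullivan2021, §1 ("`J^{2,n}(X)` is hyperbolic if and only if `γ(n+1)² ≥ γ(n)γ(n+2)`")] -/
theorem not_splits_jensenPoly_two {a : ℕ → ℝ} {k : ℕ} (h2 : 0 < a (k + 2))
    (hT : a (k + 1) ^ 2 < a k * a (k + 2)) : ¬ (jensenPoly a 2 k).Splits := by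
  intro hs
  have hdeg : (jensenPoly a 2 k).natDegree = 2 := natDegree_jensenPoly a 2 k h2.ne'
  have hne : jensenPoly a 2 k ≠ 0 := by
    intro h
    rw [h, natDegree_zero] at hdeg
    exact absurd hdeg (by norm_num)
  have hdeg' : (jensenPoly a 2 k).degree ≠ 0 := by
    rw [degree_eq_natDegree hne, hdeg]
    norm_num
  obtain ⟨x, hx⟩ := hs.exists_eval_eq_zero hdeg'
  rw [eval_jensenPoly_two] at hx
  refine quadratic_ne_zero_of_discrim_ne_sq (fun s hs' => ?_) x hx
  rw [discrim] at hs'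
  nlinarith [sq_nonneg s]

/-- **Barrier `JensenPolynomialsNarrow` (audit 2026-08-16 of `JensenPolynomials`: Farmer's "large
shifts carry no information", pinned to the Hermite-universality class in the form GORZ establish for
`γ`, with `γ` itself as base point).** For every index `k` there is a positive sequence `β` which
agrees with the Taylor coefficients `γ = xiTaylorCoeff` of `(-1+4z²)Λ(½+z)` at every index except
`k + 1` (where `β(k+1) = √(γ(k)γ(k+2))/2`), and therefore
* satisfies GORZ's universality hypotheses §5.1 (15) for EVERY degree (`HasGORZExpansion β`: for
  `γ` the tree's theorem `xiTaylorCoeff_logRatio_holds`; the hypotheses are asymptotic in the shift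
  `n`), hence has Hermite limits in the derivative aspect (`HasGORZExpansion.tendsto_coeff_rescaled`)
  and is `EventuallyHyperbolic` (GORZ Thm. 3/6 + Corollary — the shape of GORZ Thm. 1);
* has literally the same Jensen polynomials as `γ` at every shift `n > k + 1` and on every window
  `n + d < k + 1` — in particular every shift-`0` polynomial `J^{d,0}_γ`, `d ≤ k` (Chasse's input
  `GORZ2019_chasse` when `k ≥ 2·10^17`);
and yet `J^{2,k}_β` is NOT hyperbolic (Turán's inequality fails at shift `k`), so `¬ AllHyperbolic β`.
Hence no inference "(15) for all `d` + hyperbolicity for all large shifts + shift-`0` hyperbolicity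
up to any fixed degree ⟹ `AllHyperbolic`" can be valid (`not_allHyperbolic_of_hasGORZExpansion`,
`…_chasse`), while `AllHyperbolic xiTaylorCoeff` is RH (`polya_jensen`).

BARRIER (structured block, D-0021):
- technique_class: Hermite universality in the form GORZ use for `γ` — the log-ratio expansion §5.1 (15) for every degree (`HasGORZExpansion`; tree: `jensenPoly_eventually_splits'`, `xiTaylorCoeff_logRatio_holds`) — and every consequence of it or of any other property of `γ` invariant under changing ONE Taylor coefficient: GORZ Thm. 1 (`gorz_eventually`, `eventuallyHyperbolic_xiTaylorCoeff`), effective large-shift thresholds `n ≥ N(d)` (Griffin–Ono–Rolen–Thorner–Tripp–Wagner: `n ≥ c e^{d/2}`; Holland 2026: `n³ log²(n+2) ≥ K d⁵`; O'Sullivan Thm. 1.3 for `P^{d,n}`), derivative-aspect Hermite/GUE limits; all of it combined with shift-`0` hyperbolicity up to any fixed degree (Chasse, `GORZ2019_chasse`) [cite: GORZPNAS2019, Thm. 1, Thm. 3, §5.1 eq. (15)] [cite: Farmer2022, §3 (Principle 3.3) and §4] [cite: GriffinEtAl2022, Thm. 1.1] [cite: Holland2026, Thm. 1.1 and §12] [cite: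 Osullivan2021, Thm. 1.3]
- blocks: RiemannHypothesis via Pólya's criterion `Literature.NumberTheory.LFunctions.polya_jensen` (`RH ↔ AllHyperbolic xiTaylorCoeff`) from the data in technique_class: those data hold for `β`, and `AllHyperbolic β` fails (this theorem, PROVED: `JensenPolynomialsNarrow_holds`) [cite: Farmer2022, §4]
- because: the hypotheses of GORZ Thms. 3/6/7 are statements about `n → ∞` and Chasse-type input concerns finitely many degrees at shift `0`; both survive replacing the single coefficient `γ(k+1)` by `√(γ(k)γ(k+2))/2 > 0`, which makes `disc J^{2,k} = 4(β(k+1)² − γ(k)γ(k+2)) < 0` — Farmer: "each increase in the differentiation index loses information about the location of the zeros"; for his `X_{10}` every `J^{d,n}`, `n ≥ 1`, and every `J^{d,0}`, `d ≤ 118`, is hyperbolic although "RH" fails [cite: Farmer2022, §4] [cite: GORZPNAS2019, §5.1]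
- evasions_known: none published; Holland 2026 §12: "This result controls an asymptotic region and does not provide a converse route from partial Jensen hyperbolicity to the Riemann hypothesis; see Farmer". NOT in the class and NOT neutralised by this witness (which violates Turán at shift `k`): shift-UNIFORM hyperbolicity at bounded degree — `J^{d,n}_γ` hyperbolic for ALL `n` when `d ≤ 3` (Csordas–Norfolk–Varga 1986, Dimitrov–Lucas 2011), `d ≤ 8` (GORZ Thm. 2, `gorz_le_eight`), `d ≤ 64` (tree: `jensenPoly_xiTaylorCoeff_splits_of_le`), `4d ≤ T²` from RH to height `T` (Kim–Lee Thm. 4; Chasse); its extension to all `d` is `AllHyperbolic γ` = RH itself, and bounded-degree all-shift data do not suffice either: Farmer's `X_{10}` (from a graph) and, PROVED for every degree bound `D`, `JensenPolynomialsShiftUniform_holds` (`JensenPolynomialsCone.lean`) [cite: Holland2026, §12] [cite: GORZPNAS2019, Thm. 2] [cite: KimLee2021, Thm. 4 and Remark] [cite: Farmer2022, §4]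
- status: established (proved here from the tree's unconditional `xiTaylorCoeff_logRatio_holds` and `xiTaylorCoeff_pos_holds`; standard axioms)
- scope_caveats: sharpens `JensenPolynomials`, whose witness `quadExp` lies in the Kim–Farmer class but not in the universality class (its `J^{d+2,n} = (X+1)^d Q` have a `d`-fold root; rescaled limit at `d = 3` is `{−2, 1 ± √3}`, not the roots of `H₃`) and violates Turán at shift `0`; the literal hypothesis (4) of Thm. 3 (`GORZ2019_thm3_corollary`) forces `Δ³ log α = o(δ^d)` (`isLittleO_thirdDiff_of_gorzThm3`) and fails for `γ` for `d ≥ 4` (paper computation) — the peg is (15); the theorem says nothing against proving `AllHyperbolic xiTaylorCoeff` by a degree-uniform argument at shift `0`, nor against mechanisms using shift-uniform structure of `n ↦ γ(n)` (e.g. the moment representation `γ(n) = 64·4ⁿ n!/(2n)! ∫₀^∞ Φ(u)u^{2n} du`, total positivity), which no single-coefficient modification preserves; a witness in the universality class that ALSO keeps all-shift hyperbolicity up to a prescribed degree `D` (zeros in a thin cone — Farmer's `X_{10}` pattern) is `JensenPolynomialsShiftUniform` (`JensenPolynomialsCone.lean`, proved for every `D`)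

[cite: Farmer2022, §3 and §4] [cite: GORZPNAS2019, Thm. 3, Thm. 6, §5.1 eq. (15)] -/
def JensenPolynomialsNarrow : Prop :=
  ∀ k : ℕ, ∃ β : ℕ → ℝ,
    (∀ n, n ≠ k + 1 → β n = xiTaylorCoeff n) ∧
    (∀ n, 0 < β n) ∧
    HasGORZExpansion β ∧
    EventuallyHyperbolic β ∧
    (∀ d n : ℕ, k + 1 < n → jensenPoly β d n = jensenPoly xiTaylorCoeff d n) ∧
    (∀ d n : ℕ, n + d < k + 1 → jensenPoly β d n = jensenPoly xiTaylorCoeff d n) ∧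
    ¬ (jensenPoly β 2 k).Splits

/-- **The sharpened barrier holds**, witnessed by `β = Function.update γ (k+1) (√(γ(k)γ(k+2))/2)`.
[cite: Farmer2022, §4] [cite: GORZPNAS2019, §5.1 eq. (15)] -/
theorem JensenPolynomialsNarrow_holds : JensenPolynomialsNarrow := by
  intro k
  have hpos : ∀ n, 0 < xiTaylorCoeff n := xiTaylorCoeff_pos_holds
  set c : ℝ := Real.sqrt (xiTaylorCoeff k * xiTaylorCoeff (k + 2)) / 2 with hc
  have hprod : 0 < xiTaylorCoeff k * xiTaylorCoeff (k + 2) := mul_pos (hpos k) (hpos (k + 2))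
  have hc0 : 0 < c := div_pos (Real.sqrt_pos.2 hprod) two_pos
  have hcsq : c ^ 2 = xiTaylorCoeff k * xiTaylorCoeff (k + 2) / 4 := by
    rw [hc, div_pow, Real.sq_sqrt hprod.le]
    norm_num
  set β : ℕ → ℝ := Function.update xiTaylorCoeff (k + 1) c with hβ
  have hβ_ne : ∀ n, n ≠ k + 1 → β n = xiTaylorCoeff n := fun n hn => Function.update_of_ne hn _ _
  have hβ_at : β (k + 1) = c := Function.update_self _ _ _
  have hβpos : ∀ n, 0 < β n := by
    intro n
    by_cases hn : n = k + 1
    · rw [hn, hβ_at]; exact hc0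
    · rw [hβ_ne n hn]; exact hpos n
  have hev : ∀ᶠ n in atTop, xiTaylorCoeff n = β n := by
    filter_upwards [eventually_gt_atTop (k + 1)] with n hn
    exact (hβ_ne n hn.ne').symm
  have hG : HasGORZExpansion β := hasGORZExpansion_xiTaylorCoeff.congr hev
  have hwindow : ∀ d n, (∀ j, j ≤ d → n + j ≠ k + 1) →
      jensenPoly β d n = jensenPoly xiTaylorCoeff d n := by
    intro d n h
    unfold jensenPoly
    refine Finset.sum_congr rfl fun j hj => ?_
    rw [hβ_ne (n + j) (h j (Nat.lt_succ_iff.mp (Finset.mem_range.mp hj)))]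
  refine ⟨β, hβ_ne, hβpos, hG, hG.eventuallyHyperbolic hβpos,
    fun d n hn => hwindow d n fun j _ => by omega,
    fun d n hn => hwindow d n fun j hj => by omega, ?_⟩
  refine not_splits_jensenPoly_two (hβpos (k + 2)) ?_
  rw [hβ_at, hβ_ne k (by omega), hβ_ne (k + 2) (by omega), hcsq]
  nlinarith

/-- Corollary: **the Hermite-universality class (for every degree) together with large-shift
hyperbolicity does not imply full hyperbolicity** — with a positive witness obtained from `γ` by
changing `γ(1)`. [cite: Farmer2022, §3 and §4] -/
theorem exists_hasGORZExpansion_not_allHyperbolic :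
    ∃ β : ℕ → ℝ, (∀ n, 0 < β n) ∧ HasGORZExpansion β ∧ EventuallyHyperbolic β ∧
      ¬ AllHyperbolic β := by
  obtain ⟨β, -, hpos, hG, hE, -, -, hns⟩ := JensenPolynomialsNarrow_holds 0
  exact ⟨β, hpos, hG, hE, fun h => hns (h 2 0)⟩

/-- Corollary: **no inference from universality + large shifts + every Jensen polynomial of `γ` on
the windows `n + d < K`** (in particular all `J^{d,0}_γ`, `d < K`, whatever is known about them) to
`AllHyperbolic`, for any `K`. [cite: Farmer2022, §4] -/
theorem not_allHyperbolic_of_hasGORZExpansion (K : ℕ) :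
    ¬ ∀ β : ℕ → ℝ, (∀ n, 0 < β n) → HasGORZExpansion β → EventuallyHyperbolic β →
      (∀ d n : ℕ, n + d < K → jensenPoly β d n = jensenPoly xiTaylorCoeff d n) →
      AllHyperbolic β := by
  intro h
  obtain ⟨β, -, hpos, hG, hE, -, hlow, hns⟩ := JensenPolynomialsNarrow_holds K
  exact hns (h β hpos hG hE (fun d n hnd => hlow d n (by omega)) 2 K)

/-- Corollary: **… nor together with Chasse's shift-`0` verification** (`GORZ2019_chasse`:
`J^{d,0}` hyperbolic for `d ≤ 2·10^17`): a sequence can share all of it with `γ` and fail to be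
`AllHyperbolic`. [cite: Farmer2022, §4] [cite: GORZPNAS2019, §1 (footnote: Chasse)] -/
theorem not_allHyperbolic_of_hasGORZExpansion_chasse (hC : GORZ2019_chasse) :
    ¬ ∀ β : ℕ → ℝ, (∀ n, 0 < β n) → HasGORZExpansion β → EventuallyHyperbolic β →
      (∀ d : ℕ, d ≤ 2 * 10 ^ 17 → (jensenPoly β d 0).Splits) → AllHyperbolic β := by
  intro h
  obtain ⟨β, -, hpos, hG, hE, -, hlow, hns⟩ := JensenPolynomialsNarrow_holds (2 * 10 ^ 17)
  refine hns (h β hpos hG hE (fun d hd => ?_) 2 (2 * 10 ^ 17))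
  rw [hlow d 0 (by omega)]
  exact hC d hd

end Audit

end Literature.Barriers.RiemannHypothesis
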